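import Summits.CriticalPhenomena.Ising3DConformalLimit.Theses.EnergyNotSigmaSquared
import Summits.CriticalPhenomena.Ising3DConformalLimit.Theorems.GapForcesFarMerging.Negative.IsingCertificate
import Summits.CriticalPhenomena.Ising3DConformalLimit.Theorems.MoebiusLimitExists.Negative.FreePermutations
import Literature.Probability.LatticeModels.CriticalUrsellFourSign
import Literature.Probability.LatticeModels.MessagerMiracleSole
import Literature.Probability.LatticeModels.CriticalTwoPointLower
import Literature.Probability.LatticeModels.HighDimPointwiseTriviality

/-!
# The un-pinched envelope `0 ≤ ⟨σ_{me₂}σ_{-me₂} ; σ_{up m}σ_{dn m}⟩ ≤ 2⟨σ₀σ_{2me₁}⟩²`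
(line rp-unpinch-single-passage of crux GapForcesFarMerging, item stmt-CriticalPhenomena-4468;
stub `stub_unpinchedEnvelope`)

For `m ≥ 1` put `p = m e₂ = Pi.single 1 m`, `q = -m e₂`, `xR = 2m e₁ = Pi.single 0 (2m)`,
`up m = xR + m e₂ = (2m, m, 0)`, `dn m = xR - m e₂ = (2m, -m, 0)` (so `p, q` are the mirror images of
`up m, dn m` through the site plane `{x₀ = m}`). The pair–pair truncation
`⟨σ_pσ_q ; σ_{up}σ_{dn}⟩ := ⟨σ_pσ_qσ_{up}σ_{dn}⟩_{β_c} - ⟨σ_pσ_q⟩_{β_c}⟨σ_{up}σ_{dn}⟩_{β_c}` of the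
critical nearest-neighbour Ising model on `ℤ³` satisfies

* `0 ≤ ⟨σ_pσ_q ; σ_{up}σ_{dn}⟩` — GKS II with multiplicities (`criticalCorr_griffiths`);
* `⟨σ_pσ_q ; σ_{up}σ_{dn}⟩ ≤ 2⟨σ₀σ_{xR}⟩²_{β_c}` — Lebowitz' inequality `U₄ ≤ 0`
  (`criticalUrsellFour_nonpos`) bounds the truncation by the two other pairings
  `⟨σ_pσ_{up}⟩⟨σ_qσ_{dn}⟩ + ⟨σ_pσ_{dn}⟩⟨σ_qσ_{up}⟩ = G(xR)² + G(xR - 2me₂) G(xR + 2me₂)`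
  (`criticalCorr_two_pair`), and `G(xR - 2me₂) = G(xR + 2me₂) ≤ G(xR)` by the coordinate reflection
  `x₁ ↦ -x₁` (`twoPointPlus_reflection_invariant_holds`) and Messager–Miracle-Solé monotonicity along
  the second axis (`messager_miracleSole_holds`, iterated: `twoPointPlus_add_single_le`).

This is the envelope of the un-pinched pair–pair factor of the reflection-positivity Gram minor of the
line; it is used once, in the glue `gapGivesSinglePinch` of the lead skeleton.

## References

* J. L. Lebowitz, Comm. Math. Phys. 35 (1974) 87–92, Theorem, eq. (2.5b) [Lebowitz1974].
* A. Messager, S. Miracle-Solé, J. Stat. Phys. 17 (1977) 245–262, main theorem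
  [MessagerMiracleSoleJSP1977].
* S. Friedli, Y. Velenik, *Statistical Mechanics of Lattice Systems* (CUP 2017), Thm 3.20
  [FriedliVelenik2017].
-/

noncomputable section

namespace Summit.CriticalPhenomena.Ising3DConformalLimit.EnergyNotSigmaSquaredGapForcesFarMerging

open Literature.Probability.LatticeModels
open Summit.CriticalPhenomena.Ising3DConformalLimit.Theses.EnergyNotSigmaSquared
open Summit.CriticalPhenomena.Ising3DConformalLimit.Theorems.GapForcesFarMerging.Negative
  (e₁ e₂ cc2 FarMergingShape criticalCorr_griffiths)

/-- GKS II for the pair–pair truncation: `0 ≤ ⟨σ_aσ_bσ_cσ_e⟩_{β_c} - ⟨σ_aσ_b⟩_{β_c}⟨σ_cσ_e⟩_{β_c}`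
on `ℤ³` (coincidences allowed). [cite: FriedliVelenik2017, Thm. 3.20, eq. (3.22), p. 109] -/
theorem pairPairTruncation_nonneg (a b c e : Site 3) :
    0 ≤ criticalCorr 3 4 ![a, b, c, e] - criticalCorr 3 2 ![a, b] * criticalCorr 3 2 ![c, e] := by
  have h := criticalCorr_griffiths ![a, b, c, e]
  simp only [Matrix.cons_val_zero, Matrix.cons_val_one, Matrix.cons_val] at h
  change criticalCorr 3 2 ![a, b] * criticalCorr 3 2 ![c, e] ≤ criticalCorr 3 4 ![a, b, c, e] at h
  linarith

/-- Lebowitz' inequality for the pair–pair truncation on `ℤ³`, with the two remaining pairings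
written as critical two-point functions of the difference vectors:
`⟨σ_aσ_bσ_cσ_e⟩ - ⟨σ_aσ_b⟩⟨σ_cσ_e⟩ ≤ G(c - a) G(e - b) + G(e - a) G(c - b)`.
[cite: Lebowitz1974, Theorem, eq. (2.5b)] -/
theorem pairPairTruncation_le_pairings (a b c e : Site 3) :
    criticalCorr 3 4 ![a, b, c, e] - criticalCorr 3 2 ![a, b] * criticalCorr 3 2 ![c, e] ≤
      criticalTwoPoint 3 (c - a) * criticalTwoPoint 3 (e - b) +
        criticalTwoPoint 3 (e - a) * criticalTwoPoint 3 (c - b) := by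
  have h := criticalUrsellFour_nonpos (d := 3) le_rfl ![a, b, c, e]
  simp only [Matrix.cons_val_zero, Matrix.cons_val_one, Matrix.cons_val] at h
  rw [criticalCorr_two_pair a c, criticalCorr_two_pair b e, criticalCorr_two_pair a e,
    criticalCorr_two_pair b c] at h
  linarith

/-- Messager–Miracle-Solé along the second axis from an axis point, iterated `k` times:
`G(n e₁ + k e₂) ≤ G(n e₁)` at `β_c` on `ℤ³`.
[cite: MessagerMiracleSoleJSP1977, main theorem (monotonicity of ⟨σ₀σ_x⟩ under reflections)] -/
theorem criticalTwoPoint_axis_add_single_one_le (n : ℤ) (k : ℕ) :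
    criticalTwoPoint 3 (Pi.single 0 n + Pi.single 1 (k : ℤ)) ≤ criticalTwoPoint 3 (Pi.single 0 n) :=
  twoPointPlus_add_single_le messager_miracleSole_holds (criticalBeta_nonneg 3)
    (Pi.single 0 n : Site 3) 1 (by simp) k

/-- The coordinate reflection `x₁ ↦ -x₁` of the critical two-point function at an off-axis point:
`G(n e₁ - k e₂) = G(n e₁ + k e₂)` on `ℤ³`. [folklore] -/
theorem criticalTwoPoint_axis_sub_single_one_eq (n k : ℤ) :
    criticalTwoPoint 3 (Pi.single 0 n - Pi.single 1 k) =
      criticalTwoPoint 3 (Pi.single 0 n + Pi.single 1 k) := by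
  have h := twoPointPlus_reflection_invariant_holds (criticalBeta_nonneg 3) 1
    (Pi.single 0 n + Pi.single 1 k : Site 3)
  have he : Function.update (Pi.single 0 n + Pi.single 1 k : Site 3) 1
      (-((Pi.single 0 n + Pi.single 1 k : Site 3) 1)) = Pi.single 0 n - Pi.single 1 k := by
    ext j
    fin_cases j <;> simp
  rw [he] at h
  exact h

/-- **The un-pinched envelope** (stub 2 of line `rp-unpinch-single-passage`): for `m ≥ 1`,
`0 ≤ ⟨σ_{me₂}σ_{-me₂} ; σ_{up m}σ_{dn m}⟩ ≤ 2⟨σ₀σ_{2me₁}⟩²_{β_c}` with `up m = (2m, m, 0)`,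
`dn m = (2m, -m, 0)` (GKS II; Lebowitz + reflection + Messager–Miracle-Solé).
[cite: Lebowitz1974, Theorem, eq. (2.5b)] -/
theorem stub_unpinchedEnvelope :
    ∀ m : ℕ, 1 ≤ m →
      0 ≤ criticalCorr 3 4 ![Pi.single 1 (m : ℤ), Pi.single 1 (-(m : ℤ)), Pi.single 0 (2 * (m : ℤ)) + Pi.single 1 (m : ℤ), Pi.single 0 (2 * (m : ℤ)) - Pi.single 1 (m : ℤ)] - criticalCorr 3 2 ![Pi.single 1 (m : ℤ), Pi.single 1 (-(m : ℤ))] * criticalCorr 3 2 ![Pi.single 0 (2 * (m : ℤ)) + Pi.single 1 (m : ℤ), Pi.single 0 (2 * (m : ℤ)) - Pi.single 1 (m : ℤ)] ∧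
        criticalCorr 3 4 ![Pi.single 1 (m : ℤ), Pi.single 1 (-(m : ℤ)), Pi.single 0 (2 * (m : ℤ)) + Pi.single 1 (m : ℤ), Pi.single 0 (2 * (m : ℤ)) - Pi.single 1 (m : ℤ)] - criticalCorr 3 2 ![Pi.single 1 (m : ℤ), Pi.single 1 (-(m : ℤ))] * criticalCorr 3 2 ![Pi.single 0 (2 * (m : ℤ)) + Pi.single 1 (m : ℤ), Pi.single 0 (2 * (m : ℤ)) - Pi.single 1 (m : ℤ)] ≤
          2 * criticalTwoPoint 3 (Pi.single 0 (2 * (m : ℤ))) ^ 2 := by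
  intro m _
  refine ⟨pairPairTruncation_nonneg _ _ _ _, (pairPairTruncation_le_pairings _ _ _ _).trans ?_⟩
  -- the four difference vectors
  have h1 : (Pi.single 0 (2 * (m : ℤ)) + Pi.single 1 (m : ℤ) - Pi.single 1 (m : ℤ) : Site 3) =
      Pi.single 0 (2 * (m : ℤ)) := by
    ext j
    fin_cases j <;> simp
  have h2 : (Pi.single 0 (2 * (m : ℤ)) - Pi.single 1 (m : ℤ) - Pi.single 1 (-(m : ℤ)) : Site 3) =
      Pi.single 0 (2 * (m : ℤ)) := by
    ext j
    fin_cases j <;> simp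
  have h3 : (Pi.single 0 (2 * (m : ℤ)) - Pi.single 1 (m : ℤ) - Pi.single 1 (m : ℤ) : Site 3) =
      Pi.single 0 (2 * (m : ℤ)) - Pi.single 1 (((2 * m : ℕ) : ℤ)) := by
    ext j
    fin_cases j <;> simp
    ring
  have h4 : (Pi.single 0 (2 * (m : ℤ)) + Pi.single 1 (m : ℤ) - Pi.single 1 (-(m : ℤ)) : Site 3) =
      Pi.single 0 (2 * (m : ℤ)) + Pi.single 1 (((2 * m : ℕ) : ℤ)) := by
    ext j
    fin_cases j <;> simp
    ring
  rw [h1, h2, h3, h4, criticalTwoPoint_axis_sub_single_one_eq]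
  have hmms := criticalTwoPoint_axis_add_single_one_le (2 * (m : ℤ)) (2 * m)
  have hG0 : 0 ≤ criticalTwoPoint 3 (Pi.single 0 (2 * (m : ℤ)) + Pi.single 1 (((2 * m : ℕ) : ℤ))) :=
    criticalTwoPoint_nonneg' _
  have hsq := mul_self_le_mul_self hG0 hmms
  rw [sq]
  linarith

end Summit.CriticalPhenomena.Ising3DConformalLimit.EnergyNotSigmaSquaredGapForcesFarMerging

end
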